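import Summits.ABC.IUTFork.LDHSlotResidueShareSharp
import HarnessLib

/-!
# The (Ind1) slot residue at a prime where the slot values take TWO values: the exact collection identity
# `Σ_{v⃗ ∈ V(F)_p^{m+1}} (θ(v⃗_m) − min_k θ(v⃗_k))·Π_k Pr(v⃗_k) = (a − b)·(ω − ω^{m+1})`

Record-only PROOF file (D-0012; 0 def / 0 `Prop` fact / 0 instance / 0 notation) of the abc-iut cell (seat abc-iut-c312-d1, gen 12;
row «C:PLACES-TRANSPORT-DMOD» of RULING (α), C LEAD abc-iut-plan g12 — the generic, reusable part; consumer: the Broberg file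
`LDHGenuineUnionPrintIsmBroberg.lean`). CLASSICAL finite probability; TAKES NO SIDE on [IUTchIII] Cor. 3.12.

abc-iut-S8's (Ind1) slot residue (`PilotSlotResidue.lean`) at one prime `p` is the procession average of the collection sums
`Σ_{v⃗} (θ_j(v⃗(j)) − min_k θ_j(v⃗(k)))·Π_k Pr(v⃗(k))` (`slotResidue_singleton_eq_sum`, abc-iut-s2-p2). abc-iut-s2-p2's
`inner_defect_sum_eq_of_badConst` (`LDHSlotResidueShareExact.lean`) evaluates them when `θ_j` is constant on the bad places (value `a`)
and `0` on the good ones. HERE the general TWO-VALUED case — `θ = a` on a set `Z` of places over `p`, `θ = b ≤ a` off `Z` — which is the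
shape at a prime that SPLITS into two bad places of unequal `q`-order (Broberg's `3 = 𝔭₃𝔭₃'`, orders `2 | 24`), by the same two
independence identities (abc-iut-s2-p2's `sum_prodInit_mul_last_mul_prod_weight`, `sum_last_mul_prod_weight`):

* **`sum_last_sub_inf_mul_prod_weight_eq_of_twoValued`** — for probability weights `w` on a finite type `S`, `θ = a` on `Z`, `θ = b ≤ a`
  off `Z`, `ω = Σ_{s∈Z} w(s)`: `Σ_{e ∈ S^{m+1}} (θ(e_m) − min_k θ(e_k))·Π_k w(e_k) = (a − b)·(ω − ω^{m+1})` (the least slot is `a` iff all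
  `m+1` slots fall in `Z`, probability `ω^{m+1}`; the last slot has mean `aω + b(1−ω)`);
* **`PilotData.slotResidue_singleton_eq_of_twoValued`** — for pilot data `X` over `F` whose normalised `q`-heights
  `μ(v) = P_q(v)·ln N(v)/n_v` take the value `a` on `Z ⊆ V(F)_p` and `b ≤ a` off `Z`:
  `slotResidue X {p} = (a − b)·(1/ℓ⋆)·Σ_{i<ℓ⋆} (i+1)²·(ω − ω^{i+2})` (`θ_{i+1} = (i+1)²·μ`, abc-iut-S8's `slotValue_eq_sq_mul`).

[cite: DupuyHilado2025, §3.6, §4.7] [cite: Mochizuki2012, IUTchIV Thm. 1.10 Step (v) p. 27–28] [claim: Mochizuki2012, status: disputed] for the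
IUT locator only. Nothing here concerns any particular point or datum.
-/

noncomputable section

namespace Literature.IUT.LogVolume

open NumberField IsDedekindDomain Finset

namespace PilotData

/-! ## 1. The two-valued collection identity on a finite probability space -/

/-- **Two-valued collection identity.** For weights `w` on a finite type `S` with `Σ_s w(s) = 1`, a function `θ` equal to `a` on
`Z` and to `b ≤ a` off `Z`, and `ω := Σ_{s∈Z} w(s)`:
`Σ_{e ∈ S^{m+1}} (θ(e_m) − min_k θ(e_k))·Π_k w(e_k) = (a − b)·(ω − ω^{m+1})`. [cite: DupuyHilado2025, §3.6, §4.7] -/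
theorem sum_last_sub_inf_mul_prod_weight_eq_of_twoValued {S : Type*} [Fintype S] [DecidableEq S] (w : S → ℝ)
    (hw : ∑ s, w s = 1) (Z : Finset S) (θ : S → ℝ) {a b : ℝ} (hab : b ≤ a)
    (ha : ∀ s ∈ Z, θ s = a) (hb : ∀ s ∉ Z, θ s = b) (m : ℕ) :
    ∑ e : Fin (m + 1) → S,
        (θ (e (Fin.last m)) - Finset.univ.inf' Finset.univ_nonempty (fun k => θ (e k))) * ∏ k, w (e k) =
      (a - b) * ((∑ s ∈ Z, w s) - (∑ s ∈ Z, w s) ^ (m + 1)) := by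
  classical
  set ind : S → ℝ := fun s => if s ∈ Z then (1 : ℝ) else 0 with hind
  -- the least slot: `a` if every slot lies in `Z`, `b` otherwise; i.e. `b + (a − b)·Π_k 𝟙_Z(e_k)`
  have hinf : ∀ e : Fin (m + 1) → S,
      Finset.univ.inf' Finset.univ_nonempty (fun k => θ (e k)) =
        b + (a - b) * ((∏ j : Fin m, ind (e (Fin.castSucc j))) * ind (e (Fin.last m))) := by
    intro e
    have hprod : (∏ j : Fin m, ind (e (Fin.castSucc j))) * ind (e (Fin.last m)) = ∏ k, ind (e k) :=
      (Fin.prod_univ_castSucc (fun k => ind (e k))).symm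
    rw [hprod]
    by_cases hall : ∀ k : Fin (m + 1), e k ∈ Z
    · have h1 : ∏ k, ind (e k) = 1 := Finset.prod_eq_one fun k _ => by simp only [hind, hall k, if_true]
      rw [h1, mul_one, add_sub_cancel]
      refine le_antisymm ((Finset.inf'_le _ (Finset.mem_univ (0 : Fin (m + 1)))).trans (ha _ (hall 0)).le)
        (Finset.le_inf' _ _ fun k _ => (ha _ (hall k)).ge)
    · push Not at hall
      obtain ⟨k, hk⟩ := hall
      have h0 : ∏ k, ind (e k) = 0 := Finset.prod_eq_zero (Finset.mem_univ k) (by simp only [hind, hk, if_false])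
      rw [h0, mul_zero, add_zero]
      refine le_antisymm ((Finset.inf'_le _ (Finset.mem_univ k)).trans (hb _ hk).le) (Finset.le_inf' _ _ fun k' _ => ?_)
      by_cases hk' : e k' ∈ Z
      · rw [ha _ hk']; exact hab
      · rw [hb _ hk']
  -- the last-slot marginal
  have hlast : ∑ e : Fin (m + 1) → S, θ (e (Fin.last m)) * ∏ k, w (e k) =
      a * (∑ s ∈ Z, w s) + b * (1 - ∑ s ∈ Z, w s) := by
    rw [sum_last_mul_prod_weight w hw θ]
    have hsplit : ∑ s, θ s * w s = ∑ s ∈ Z, θ s * w s + ∑ s ∈ Finset.univ \ Z, θ s * w s := by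
      rw [← Finset.sum_union Finset.disjoint_sdiff, Finset.union_sdiff_of_subset (Finset.subset_univ Z)]
    have hZ : ∑ s ∈ Z, θ s * w s = a * ∑ s ∈ Z, w s := by
      rw [Finset.mul_sum]
      exact Finset.sum_congr rfl fun s hs => by rw [ha s hs]
    have hZc : ∑ s ∈ Finset.univ \ Z, θ s * w s = b * (1 - ∑ s ∈ Z, w s) := by
      have hc : ∑ s ∈ Finset.univ \ Z, w s = 1 - ∑ s ∈ Z, w s := by
        rw [Finset.sum_sdiff_eq_sub (Finset.subset_univ Z), hw]
      rw [← hc, Finset.mul_sum]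
      exact Finset.sum_congr rfl fun s hs => by rw [hb s (Finset.mem_sdiff.mp hs).2]
    rw [hsplit, hZ, hZc]
  -- the all-in-`Z` probability
  have hall : ∑ e : Fin (m + 1) → S,
      ((∏ j : Fin m, ind (e (Fin.castSucc j))) * ind (e (Fin.last m))) * ∏ k, w (e k) =
        (∑ s ∈ Z, w s) ^ (m + 1) := by
    rw [sum_prodInit_mul_last_mul_prod_weight w ind ind]
    have hi : ∑ s, w s * ind s = ∑ s ∈ Z, w s := by
      rw [← Finset.sum_filter_add_sum_filter_not Finset.univ (fun s => s ∈ Z)]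
      have h1 : ∑ s ∈ Finset.univ.filter (fun s => s ∈ Z), w s * ind s = ∑ s ∈ Z, w s := by
        rw [Finset.filter_mem_eq_inter, Finset.univ_inter]
        exact Finset.sum_congr rfl fun s hs => by simp only [hind, hs, if_true, mul_one]
      have h2 : ∑ s ∈ Finset.univ.filter (fun s => ¬ s ∈ Z), w s * ind s = 0 :=
        Finset.sum_eq_zero fun s hs => by
          simp only [Finset.mem_filter, Finset.mem_univ, true_and] at hs
          simp only [hind, hs, if_false, mul_zero]
      rw [h1, h2, add_zero]
    rw [hi, pow_succ]
  -- total weight of the collections is `1`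
  have htot : ∑ e : Fin (m + 1) → S, ∏ k, w (e k) = 1 := by
    have h := sum_prodInit_mul_last_mul_prod_weight w (m := m) (fun _ => (1 : ℝ)) (fun _ => (1 : ℝ))
    simp only [Finset.prod_const_one, one_mul, mul_one, hw, one_pow] at h
    exact h
  calc ∑ e : Fin (m + 1) → S,
        (θ (e (Fin.last m)) - Finset.univ.inf' Finset.univ_nonempty (fun k => θ (e k))) * ∏ k, w (e k)
      = ∑ e : Fin (m + 1) → S, (θ (e (Fin.last m)) * ∏ k, w (e k)
          - (b * ∏ k, w (e k) + (a - b) * (((∏ j : Fin m, ind (e (Fin.castSucc j))) * ind (e (Fin.last m))) * ∏ k, w (e k)))) := by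
        refine Finset.sum_congr rfl fun e _ => ?_
        rw [hinf e]; ring
    _ = (a * (∑ s ∈ Z, w s) + b * (1 - ∑ s ∈ Z, w s)) - (b * 1 + (a - b) * (∑ s ∈ Z, w s) ^ (m + 1)) := by
        rw [Finset.sum_sub_distrib, hlast, Finset.sum_add_distrib, ← Finset.mul_sum, htot, ← Finset.mul_sum, hall]
    _ = (a - b) * ((∑ s ∈ Z, w s) - (∑ s ∈ Z, w s) ^ (m + 1)) := by ring

/-! ## 2. The residue of pilot data at a two-valued prime -/

variable {F : Type*} [Field F] [NumberField F] (X : PilotData F)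

/-- **The (Ind1) slot residue at a prime where the normalised `q`-heights take two values.** If
`μ(v) := P_q(v)·ln N(v)/n_v` equals `a` on `Z ⊆ V(F)_p` and `b ≤ a` off `Z` (over `p`), then with `ω := Σ_{v∈Z} Pr(v)`:
`slotResidue X {p} = (a − b)·(1/ℓ⋆)·Σ_{i<ℓ⋆} (i+1)²·(ω − ω^{i+2})` (`θ_{i+1}(v) = (i+1)²·μ(v)`, abc-iut-S8's `slotValue_eq_sq_mul`;
collection length `i+2`). E.g. a prime split into two places of equal weight `½` carrying `q`-orders `h > h'`:
`(h − h′)·ln p/(2l) · (1/ℓ⋆)Σ_i (i+1)²(½ − 2^{−(i+2)})`. [cite: DupuyHilado2025, §3.3, §3.6, §4.7]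
[cite: Mochizuki2012, IUTchIV Thm. 1.10 Step (v) p. 27–28] [claim: Mochizuki2012, status: disputed] -/
theorem slotResidue_singleton_eq_of_twoValued (p : ℕ) [Fact p.Prime] (Z : Finset (placesOver F p)) {a b : ℝ}
    (hab : b ≤ a)
    (ha : ∀ v ∈ Z, X.qPilot v.1 * logNorm F v.1 / (localDegree F v.1 : ℝ) = a)
    (hb : ∀ v : placesOver F p, v ∉ Z → X.qPilot v.1 * logNorm F v.1 / (localDegree F v.1 : ℝ) = b) :
    X.slotResidue {p} =
      (a - b) * ((1 / (X.lstar : ℝ)) * ∑ i : Fin X.lstar, (((i : ℕ) + 1 : ℝ) ^ 2) *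
        ((∑ v ∈ Z, weight F v.1) - (∑ v ∈ Z, weight F v.1) ^ ((i : ℕ) + 2))) := by
  classical
  rw [X.slotResidue_singleton_eq_sum p, Finset.mul_sum, Finset.mul_sum, Finset.mul_sum]
  refine Finset.sum_congr rfl fun i _ => ?_
  have hsq : (0 : ℝ) ≤ ((i : ℕ) + 1 : ℝ) ^ 2 := sq_nonneg _
  have key := sum_last_sub_inf_mul_prod_weight_eq_of_twoValued (fun v : placesOver F p => weight F v.1)
    (sum_weight_placesOver p) Z (fun v => X.slotValue i v.1)
    (a := (((i : ℕ) + 1 : ℝ) ^ 2) * a) (b := (((i : ℕ) + 1 : ℝ) ^ 2) * b) (mul_le_mul_of_nonneg_left hab hsq)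
    (fun v hv => by rw [slotValue_eq_sq_mul, ha v hv]) (fun v hv => by rw [slotValue_eq_sq_mul, hb v hv]) ((i : ℕ) + 1)
  rw [key]
  ring

end PilotData

end Literature.IUT.LogVolume

end
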